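import Mathlib

/-!
# Arithmetic of the dual degree-4 sieve on symplectic types (pub-hsemireg, S4-PUSH corner 2)

Kernel legs for three one-line integer arguments on sorted 6-tuples of exponents («symplectic types» of a
rank-12 lattice at a prime `p`) that carry class-level verdicts of corner 2 (twisted sheaves ∕ complexes at
`n = 6`, cell `pub-hsemireg`), filed by s4-search-2 gen 12.  In each case the modelling step (why the type
of the design lattice satisfies these inequalities: FACT 1 ∕ FACT 2 of gs-eng-2's THEOREM A, resp. (D1)–(D2) of
s4-search-2's PREREG-S2-17) is NOT formalised here; only the arithmetic that the pencil texts then perform is.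

* `pairSum_obstruction` — gs-eng-2's PAIR-SUM COROLLARY (`general-structure/XCHECK-SO2-gs2.md` §4; read and
  concurred by s4-search-2 g8, memo GAUGE-search-2-g8 §0): if all fifteen pair sums satisfy `c i + c j ≥ -v`,
  `Σ c = -3 v` and `v` is odd, contradiction («every pair sum equals −v and all cᵢ = −v∕2 ∉ ℤ»).  This is the
  arithmetic that kills the 90-class ℚ(√−3) residue of S4-PR-37 at `p = 3` (RESULT S4-PR-40, the pencil route).
* `star_shape_of_pairSum_ge_one` — COROLLARY (D5)(a) of PREREG-S2-17 (memo DUAL4-search-2-g10 §1): a sorted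
  6-tuple of integers with all pair sums `≥ 1` (condition (i) at `v = v₂(σ₂) = 1`) and total `≤ 5` is exactly
  `(0,1,1,1,1,1)` with total `5` — whose graph `E = {ij : 1 + cᵢ + cⱼ = 2}` is the 5-LEAF STAR, excluded by
  the divided-square lemma (D3) (`DividedSquareLemma.lean`); with total `≤ 4` there is no tuple at all.  This is
  the arithmetic behind «all 1 004 R4-undecided `p = 2` pairs are DUAL-DEAD» (RESULT S4-PR-50).
* `no_edge_of_min_pair_gt` ∕ `edge_iff_star` ∕ `edge_iff_clique` (∕ `levelset_initial`) — the SHAPE TRICHOTOMY of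
  PREREG-S2-17 §1 (D2)(ii): for a sorted integer type `c` and valuation `v` with `v + cᵢ + cⱼ ≥ 2` for all `i < j`
  (condition (i)), the graph `E = {i<j : v + cᵢ + cⱼ = 2}` is EMPTY (when `v + c₀ + c₁ > 2`), or the STAR centred
  at slot `0` with leaf set `{j : cⱼ = c₁}` (when `v + c₀ + c₁ = 2`, `c₀ < c₁`), or the COMPLETE graph on the
  initial segment `{j : cⱼ = c₀}` (when `v + c₀ + c₁ = 2`, `c₀ = c₁`) — exactly the three cases the divided-square
  lemma (D3) then decides.
* `clique_shape_of_pairSum_ge_two` — COROLLARY (D5)(b): at `v = 0` (all pair sums `≥ 2`) and total `6` the only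
  sorted tuple is `1⁶` (graph `K₆`, the «tight» survivor type of the 1 548 tight pairs).

Honest framing: elementary integer arithmetic (theorems only, count-neutral; `omega` after instantiating the
finitely many inequalities); class-level bookkeeping of a necessary-condition sieve at the special fibre;
nothing here bears on HC ∕ HC_CM ∕ HC_AV, and nothing here is an object, a σ or a Hodge statement.
-/

namespace Summit.Ventures.HSemireg.DualSieveArithmetic

/-- **PAIR-SUM obstruction** (gs-eng-2, XCHECK-SO2-gs2 §4, PAIR-SUM COROLLARY; as printed for six slots).  For
integers `c₀,…,c₅` with every pair sum `cᵢ + cⱼ ≥ -v` (`i ≠ j`), total `Σ cᵢ = -3v` and `v` odd: impossible —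
the fifteen pair conditions sum to `5 Σ cᵢ ≥ -15 v`, an equality, so each pair sum is `-v` and `2 cᵢ = -v`. -/
theorem pairSum_obstruction (c : Fin 6 → ℤ) (v : ℤ) (hv : Odd v)
    (hpair : ∀ i j : Fin 6, i ≠ j → -v ≤ c i + c j) (hsum : ∑ i, c i = -3 * v) : False := by
  obtain ⟨k, hk⟩ := hv
  rw [Fin.sum_univ_six] at hsum
  have h01 := hpair 0 1 (by decide)
  have h02 := hpair 0 2 (by decide)
  have h12 := hpair 1 2 (by decide)
  have h03 := hpair 0 3 (by decide)
  have h13 := hpair 1 3 (by decide)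
  have h23 := hpair 2 3 (by decide)
  have h45 := hpair 4 5 (by decide)
  have h34 := hpair 3 4 (by decide)
  have h35 := hpair 3 5 (by decide)
  have h24 := hpair 2 4 (by decide)
  have h25 := hpair 2 5 (by decide)
  have h14 := hpair 1 4 (by decide)
  have h15 := hpair 1 5 (by decide)
  have h04 := hpair 0 4 (by decide)
  have h05 := hpair 0 5 (by decide)
  omega

/-- **The `v = 1`, `s ≤ 5` shape: the 5-leaf star** (PREREG-S2-17 §1, COROLLARY (D5)(a), as printed:
«(i) needs c′₁ + c′₂ ≥ 1; sorted ⇒ Σc′ ≥ 1 + 4c′₂, so c′₂ ≤ 1, c′₁ ≥ 0, (c′₁, c′₂) = (0, 1), c′ = (0,1,1,1,1,s−4)»).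
A sorted 6-tuple of INTEGERS `c₀ ≤ c₁ ≤ … ≤ c₅` (types may have negative entries — `−1` occurs in the census —
so no sign is assumed; non-negativity of `c₀` is a CONSEQUENCE) with all pair sums `cᵢ + cⱼ ≥ 1` (`i ≠ j`;
condition (i) `v + cᵢ + cⱼ ≥ 2` at `v = v₂(σ₂) = 1`) and total `≤ 5` has total exactly `5` and is
`(0,1,1,1,1,1)`.  Its graph `{ij : 1 + cᵢ + cⱼ = 2} = {0j : j ≥ 1}` is the star with five leaves; in particular
no sorted tuple with total `≤ 4` satisfies (i).  (ℤ-form as in gs-eng-2 g23's read, `general-structure/gs2/g23/`.) -/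
theorem star_shape_of_pairSum_ge_one (c : Fin 6 → ℤ) (hsort : ∀ i j : Fin 6, i ≤ j → c i ≤ c j)
    (hpair : ∀ i j : Fin 6, i ≠ j → 1 ≤ c i + c j) (htot : ∑ i, c i ≤ 5) :
    ∑ i, c i = 5 ∧ c 0 = 0 ∧ c 1 = 1 ∧ c 2 = 1 ∧ c 3 = 1 ∧ c 4 = 1 ∧ c 5 = 1 := by
  rw [Fin.sum_univ_six] at htot ⊢
  have h01 := hpair 0 1 (by decide)
  have s01 := hsort 0 1 (by decide)
  have s12 := hsort 1 2 (by decide)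
  have s23 := hsort 2 3 (by decide)
  have s34 := hsort 3 4 (by decide)
  have s45 := hsort 4 5 (by decide)
  omega


/-! ### The shape of `E = {i<j : v + cᵢ + cⱼ = 2}` for a sorted type (PREREG-S2-17 §1 (D2)(ii)) -/

/-- **Shape trichotomy, empty case.**  For a sorted 6-tuple `c` and `v` with minimal pair value
`v + c₀ + c₁ > 2`, no pair attains `2`: the graph `E` of (D2)(ii) is EMPTY. -/
theorem no_edge_of_min_pair_gt (c : Fin 6 → ℤ) (v : ℤ) (hsort : ∀ i j : Fin 6, i ≤ j → c i ≤ c j)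
    (hmin : 2 < v + c 0 + c 1) : ∀ i j : Fin 6, i < j → v + c i + c j ≠ 2 := by
  intro i j hij
  have h0 : c 0 ≤ c i := hsort 0 i (Fin.zero_le _)
  have h1 : c 1 ≤ c j := hsort 1 j (by omega)
  omega

/-- **Shape trichotomy, star case.**  For a sorted 6-tuple `c` and `v` with `v + c₀ + c₁ = 2` and `c₀ < c₁`,
a pair `i < j` attains `2` iff `i = 0` and `cⱼ = c₁`: the graph `E` of (D2)(ii) is the STAR centred at slot `0`
with leaf set `{j ≥ 1 : cⱼ = c₁}` (an initial segment of `{1,…,5}` by `levelset_initial` applied from slot `1`). -/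
theorem edge_iff_star (c : Fin 6 → ℤ) (v : ℤ) (hsort : ∀ i j : Fin 6, i ≤ j → c i ≤ c j)
    (hmin : v + c 0 + c 1 = 2) (hlt : c 0 < c 1) :
    ∀ i j : Fin 6, i < j → (v + c i + c j = 2 ↔ i = 0 ∧ c j = c 1) := by
  intro i j hij
  have h0 : c 0 ≤ c i := hsort 0 i (Fin.zero_le _)
  have h1 : c 1 ≤ c j := hsort 1 j (by omega)
  constructor
  · intro h
    have hi0 : i = 0 := by
      by_contra hne
      have : c 1 ≤ c i := hsort 1 i (by omega)
      omega
    exact ⟨hi0, by omega⟩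
  · rintro ⟨rfl, hj⟩
    omega

/-- **Shape trichotomy, clique case.**  For a sorted 6-tuple `c` and `v` with `v + c₀ + c₁ = 2` and `c₀ = c₁`,
a pair `i < j` attains `2` iff `cᵢ = cⱼ = c₀`: the graph `E` of (D2)(ii) is the COMPLETE graph `K_m` on the
level set `{j : cⱼ = c₀}`, an initial segment `{0,…,m−1}` (`levelset_initial`), `m ≥ 2`. -/
theorem edge_iff_clique (c : Fin 6 → ℤ) (v : ℤ) (hsort : ∀ i j : Fin 6, i ≤ j → c i ≤ c j)
    (hmin : v + c 0 + c 1 = 2) (heq : c 0 = c 1) :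
    ∀ i j : Fin 6, i < j → (v + c i + c j = 2 ↔ c i = c 0 ∧ c j = c 0) := by
  intro i j hij
  have h0 : c 0 ≤ c i := hsort 0 i (Fin.zero_le _)
  have h1 : c 1 ≤ c j := hsort 1 j (by omega)
  constructor
  · intro h
    exact ⟨by omega, by omega⟩
  · rintro ⟨hi, hj⟩
    omega

/-- The level set `{j : cⱼ = c₀}` of a sorted tuple is an initial segment: if `cⱼ = c₀` and `i ≤ j` then
`cᵢ = c₀` (so the clique of `edge_iff_clique` is `K_m` on slots `0,…,m−1`, and likewise the leaf set of
`edge_iff_star` is an initial segment of the slots `≥ 1`). -/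
theorem levelset_initial (c : Fin 6 → ℤ) (hsort : ∀ i j : Fin 6, i ≤ j → c i ≤ c j)
    (i j : Fin 6) (hij : i ≤ j) (hj : c j = c 0) : c i = c 0 := by
  have h0 : c 0 ≤ c i := hsort 0 i (Fin.zero_le _)
  have h1 : c i ≤ c j := hsort i j hij
  omega

/-- **The `v = 0`, `s = 6` shape: the complete graph `K₆`** (PREREG-S2-17 §1, COROLLARY (D5)(b), corrected
wording of memo DUAL4-search-2-g10 §1 (D5)(b)).  A sorted 6-tuple of integers with all pair sums `cᵢ + cⱼ ≥ 2`
(`i ≠ j`; condition (i) at `v = 0`) and total `≤ 6` is `1⁶` with total `6` (sortedness and `c₁ ≥ 2 − c₀` give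
`Σ ≥ c₀ + 5(2 − c₀) = 10 − 4c₀`, so `c₀ ≥ 1`, hence all `cᵢ ≥ 1` and `Σ ≥ 6`); its graph `{ij : cᵢ + cⱼ = 2}` is `K₆` —
the unique «tight» survivor type.  Integer entries, no sign assumed. -/
theorem clique_shape_of_pairSum_ge_two (c : Fin 6 → ℤ) (hsort : ∀ i j : Fin 6, i ≤ j → c i ≤ c j)
    (hpair : ∀ i j : Fin 6, i ≠ j → 2 ≤ c i + c j) (htot : ∑ i, c i ≤ 6) :
    ∑ i, c i = 6 ∧ ∀ i, c i = 1 := by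
  rw [Fin.sum_univ_six] at htot ⊢
  have h01 := hpair 0 1 (by decide)
  have s01 := hsort 0 1 (by decide)
  have s12 := hsort 1 2 (by decide)
  have s23 := hsort 2 3 (by decide)
  have s34 := hsort 3 4 (by decide)
  have s45 := hsort 4 5 (by decide)
  refine ⟨by omega, fun i => ?_⟩
  fin_cases i <;> simp <;> omega

end Summit.Ventures.HSemireg.DualSieveArithmetic
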